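import Literature.NumberTheory.Sieve.SmoothCountSaddleRegimeBBounds
import HarnessLib

/-!
# Hildebrand–Tenenbaum's Theorem 1 in the range `y ≤ 8 (log x)³`

Topic `Literature/NumberTheory/Sieve`; a PROVED file toward `Literature.NumberTheory.Sieve.HTLocalBehaviour`
[HildebrandTenenbaum1986, Thm 3]. We prove the saddle-point evaluation
`Ψ(x, y) = x^α ζ(α, y)/(α√(2πφ₂(α, y))) (1 + O(log y/log x + log y/y))` uniformly for `y₀ ≤ y ≤ x`,
`y ≤ 8 (log x)³` [HildebrandTenenbaum1986, Thm 1 in that range], WITHOUT zero-free-region input: the analytic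
core `GaussSaddle.abs_rpow_mul_card_sub_main_le_tau` (Gaussian-smoothed Perron formula on `Re s = α` with the
window `τ = √(40 log y)/√φ₂`, Gaussian width `T_g = max(4, αū/1000)`, `T_d = T_g log y/2`), fed with the
near-axis bounds of `RegimeB.exists_nearAxis_params`, the ELEMENTARY middle-range decay
`RegimeB.exists_norm_smoothZetaC_le_exp_neg_mid` (`|t| ≤ y/(100 log y)` suffices because `α log x ≤ π(y)`), and
the uniform orders of `α`, `φ₂`, `φ₃`, `φ₄` (Lemmas 2 and 4). Every error is `≪ 1/ū` with
`1/ū = (1 + log x/y)/u = log y/log x + log y/y`: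

* `exists_card_smooth_saddle_regimeB`.

## References

* [HildebrandTenenbaum1986] A. Hildebrand, G. Tenenbaum, Trans. AMS 296 (1986) 265–290, Theorem 1 and §§3–5.
-/

noncomputable section

open Complex Real Finset Filter MeasureTheory

namespace Literature.NumberTheory.Sieve

namespace RegimeB

/-! ### The theorem -/

set_option maxHeartbeats 8000000 in
/-- **Hildebrand–Tenenbaum's Theorem 1 for `y ≤ 8 (log x)³`, zero-free-region free.** There are `C` and `y₀`
such that for `y₀ ≤ y ≤ x` with `y ≤ 8 (log x)³`,
`|Ψ(x, y) − x^α ζ(α, y)/(α√(2πφ₂(α, y)))| ≤ C (log y/log x + log y/y) · x^α ζ(α, y)/(α√(2πφ₂(α, y)))`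
(`α = α(x, y)`). [cite: HildebrandTenenbaum1986, Thm 1 (range y ≤ (log x)³) and §5] -/
theorem exists_card_smooth_saddle_regimeB :
    ∃ C : ℝ, ∃ y₀ : ℕ, ∀ (x : ℝ) (y : ℕ), y₀ ≤ y → (y : ℝ) ≤ x → (y : ℝ) ≤ 8 * Real.log x ^ 3 →
      |((Nat.smoothNumbersUpTo ⌊x⌋₊ (y + 1)).card : ℝ) -
          x ^ saddlePoint x y * smoothZeta (saddlePoint x y) y /
            (saddlePoint x y * Real.sqrt (2 * Real.pi * saddlePhi₂ (saddlePoint x y) y))| ≤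
        C * (Real.log y / Real.log x + Real.log y / y) *
          (x ^ saddlePoint x y * smoothZeta (saddlePoint x y) y /
            (saddlePoint x y * Real.sqrt (2 * Real.pi * saddlePhi₂ (saddlePoint x y) y))) := by
  classical
  obtain ⟨cφ, Cφ, yφ, hcφ, hCφ, -, hφ2⟩ := exists_saddlePhi₂_saddlePoint_two_sided_uniform
  obtain ⟨yα, -, hαmin⟩ := exists_min_le_saddlePoint
  obtain ⟨C₃, y₃, hC₃, -, hΦ₃u⟩ := exists_saddlePhi₃_saddlePoint_le_uniform
  obtain ⟨C₄, y₄, hC₄, -, hΦ₄u⟩ := exists_saddlePhi₄_saddlePoint_le_uniform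
  obtain ⟨yN, hnearP⟩ := exists_nearAxis_params
  obtain ⟨cd, hcd, yd, hdecP⟩ := exists_norm_smoothZetaC_le_exp_neg_mid
  obtain ⟨yk, -, hklo⟩ := exists_card_primesLE_ge
  -- ### constants
  set A₃ : ℝ := 7112 * (C₃ ^ 2 / cφ ^ 3) with hA₃
  set A₄ : ℝ := 3200 * (C₄ / cφ ^ 2) with hA₄
  have hA₃0 : 0 < A₃ := by positivity
  have hA₄0 : 0 < A₄ := by positivity
  set Cg : ℝ := 18 + 42 * Cφ with hCg
  have hCg0 : 0 < Cg := by positivity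
  set cw : ℝ := 4 + 16 * (144 / cφ + 1 / cφ) + 32 * (C₄ / cφ ^ 2 + 12 * (C₃ / cφ ^ 2) + 2 * (12 * (C₄ / cφ ^ 2))) +
    20 * (C₃ ^ 2 / cφ ^ 3) + 8800 * (C₄ / cφ ^ 2) ^ 2 with hcw
  have hcw0 : 0 < cw := by positivity
  set CB : ℝ := 500000 * (1 + cw + 70) + cw + 70 + 63000 with hCB
  -- ### eventual facts in `Y`
  have hev := (eventually_log_pow_le 4 (s := 1 / 3) (c := 1 / (3 * A₃ + 3)) (by norm_num) (by positivity)).and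
    ((eventually_log_pow_le 3 (s := 1 / 3) (c := 1 / (3 * A₄ + 3)) (by norm_num) (by positivity)).and
    ((eventually_log_pow_le 7 (s := 1 / 3) (c := cd / 162) (by norm_num) (by positivity)).and
    ((eventually_log_pow_le 6 (s := 1 / 2) (c := cd / 9) (by norm_num) (by positivity)).and
    ((eventually_log_pow_le 2 (s := 1 / 3) (c := cφ / 680) (by norm_num) (by positivity)).and
    ((eventually_log_pow_le 2 (s := 1) (c := 1 / 300) (by norm_num) (by norm_num)).and
    ((eventually_log_pow_le 1 (s := 1 / 3) (c := 1 / 8) (by norm_num) (by norm_num)).and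
    ((eventually_log_pow_le 1 (s := 3) (c := 1 / Cg) (by norm_num) (by positivity)).and
    (eventually_ge_atTop (Real.exp 100)))))))))
  obtain ⟨Z, hZ⟩ := Filter.eventually_atTop.1 hev
  refine ⟨CB, max (max (max (max yφ yα) (max y₃ y₄)) (max (max yN yd) (max yk 3))) ⌈Z⌉₊,
    fun x y hy hyx hxy8 => ?_⟩
  -- ### unpack the thresholds
  have hyA := le_trans (le_max_left _ _) hy
  have hyZ : Z ≤ y := le_trans (Nat.le_ceil Z) (by exact_mod_cast le_trans (le_max_right _ _) hy)
  have hyφ : yφ ≤ y := le_trans (le_max_left _ _) (le_trans (le_max_left _ _) (le_trans (le_max_left _ _) hyA))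
  have hyα : yα ≤ y := le_trans (le_max_right _ _) (le_trans (le_max_left _ _) (le_trans (le_max_left _ _) hyA))
  have hy₃ : y₃ ≤ y := le_trans (le_max_left _ _) (le_trans (le_max_right _ _) (le_trans (le_max_left _ _) hyA))
  have hy₄ : y₄ ≤ y := le_trans (le_max_right _ _) (le_trans (le_max_right _ _) (le_trans (le_max_left _ _) hyA))
  have hyN : yN ≤ y := le_trans (le_max_left _ _) (le_trans (le_max_left _ _) (le_trans (le_max_right _ _) hyA))
  have hyd : yd ≤ y := le_trans (le_max_right _ _) (le_trans (le_max_left _ _) (le_trans (le_max_right _ _) hyA))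
  have hyk : yk ≤ y := le_trans (le_max_left _ _) (le_trans (le_max_right _ _) (le_trans (le_max_right _ _) hyA))
  have hy3 : 3 ≤ y := le_trans (le_max_right _ _) (le_trans (le_max_right _ _) (le_trans (le_max_right _ _) hyA))
  obtain ⟨hE1, hE2, hE3, hE4, hE5, hE6, hE7, hE8, hE9⟩ := hZ y hyZ
  have hy2 : 2 ≤ y := le_trans (by norm_num) hy3
  have hy3r : (3 : ℝ) ≤ y := by exact_mod_cast hy3
  have hy0 : (0 : ℝ) < y := by linarith
  have hy1 : (1 : ℝ) < y := by linarith
  set L : ℝ := Real.log y with hL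
  have hL100 : 100 ≤ L := by
    have := Real.log_le_log (Real.exp_pos _) hE9; rwa [Real.log_exp] at this
  have hL0 : 0 < L := by linarith
  have hL1 : 1 ≤ L := by linarith
  simp only [pow_one, Real.rpow_one] at hE7 hE8 hE6
  rw [show (3 : ℝ) = ((3 : ℕ) : ℝ) by norm_num, Real.rpow_natCast] at hE8
  -- `y^{1/3}`, `y^{1/2}`
  set t3 : ℝ := (y : ℝ) ^ (1 / 3 : ℝ) with ht3
  have ht30 : 0 < t3 := Real.rpow_pos_of_pos hy0 _
  have ht3cube : t3 ^ 3 = y := by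
    rw [ht3, ← Real.rpow_natCast, ← Real.rpow_mul hy0.le]; norm_num
  have ht31 : 1 ≤ t3 := Real.one_le_rpow hy1.le (by norm_num)
  have ht3y : t3 ≤ y := by
    calc t3 = t3 ^ 1 := (pow_one _).symm
      _ ≤ t3 ^ 3 := pow_le_pow_right₀ ht31 (by norm_num)
      _ = y := ht3cube
  set t2 : ℝ := (y : ℝ) ^ (1 / 2 : ℝ) with ht2
  have ht2sq : Real.sqrt y = t2 := by rw [ht2, Real.sqrt_eq_rpow]
  -- ### `x`, `u`, `r`, `ū`
  have hx1 : 1 < x := lt_of_lt_of_le hy1 hyx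
  have hx0 : 0 < x := by linarith
  have hlogxL : L ≤ Real.log x := Real.log_le_log hy0 hyx
  have hlogx0 : 0 < Real.log x := by linarith
  have ht3logx : t3 ≤ 2 * Real.log x := by
    have h1 : (y : ℝ) ≤ (2 * Real.log x) ^ 3 := by
      have : (2 * Real.log x) ^ 3 = 8 * Real.log x ^ 3 := by ring
      linarith only [this, hxy8]
    have h2 := Real.rpow_le_rpow hy0.le h1 (by norm_num : (0 : ℝ) ≤ 1 / 3)
    rwa [← Real.rpow_natCast, ← Real.rpow_mul (by positivity), show ((3 : ℕ) : ℝ) * (1 / 3) = 1 by norm_num,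
      Real.rpow_one] at h2
  set u : ℝ := Real.log x / L with hu
  have huL : u * L = Real.log x := by rw [hu]; field_simp
  have hu0 : 0 < u := by positivity
  have hut3 : t3 ≤ 2 * L * u := by
    have : 2 * L * u = 2 * Real.log x := by rw [← huL]; ring
    linarith
  have hu1 : 1 ≤ u := by rw [hu, le_div_iff₀ hL0]; linarith
  set r : ℝ := 1 + Real.log x / y with hr
  have hrpos : 0 ≤ Real.log x / y := by positivity
  have hr1 : 1 ≤ r := by rw [hr]; linarith
  have hr0 : 0 < r := by linarith
  have hrul : r = 1 + u * L / y := by rw [hr, huL]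
  set ub : ℝ := u / r with hub
  have hub0 : 0 < ub := by positivity
  have hubu : ub ≤ u := div_le_self hu0.le hr1
  have hinvub : 1 / ub = L / Real.log x + L / y := by
    rw [hub, hrul, ← huL]; field_simp
  have hublo : t3 / (3 * L) ≤ ub := by
    rw [hub, hrul, div_le_div_iff₀ (by positivity) (by positivity)]
    have h1 : t3 * (u * L / y) ≤ u * L := by
      rw [show t3 * (u * L / y) = (t3 / y) * (u * L) by ring]
      exact mul_le_of_le_one_left (by positivity) ((div_le_one hy0).2 ht3y)
    have h2 : t3 * (1 + u * L / y) = t3 + t3 * (u * L / y) := by ring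
    rw [h2]; linarith only [h1, hut3]
  have hub1 : 1 ≤ ub := by
    refine le_trans ?_ hublo
    rw [le_div_iff₀ (by positivity)]; linarith
  have hubA₃ : A₃ * L ^ 3 + L ^ 3 ≤ ub := by
    refine le_trans ?_ hublo
    rw [le_div_iff₀ (by positivity)]
    have h1 : L ^ 4 * (3 * A₃ + 3) ≤ t3 := by
      have := hE1; rw [div_mul_eq_mul_div, one_mul, le_div_iff₀ (by positivity)] at this; linarith
    have h2 : (A₃ * L ^ 3 + L ^ 3) * (3 * L) = L ^ 4 * (3 * A₃ + 3) := by ring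
    linarith only [h1, h2]
  have hubA₄ : A₄ * L ^ 2 + L ^ 2 ≤ ub := by
    refine le_trans ?_ hublo
    rw [le_div_iff₀ (by positivity)]
    have h1 : L ^ 3 * (3 * A₄ + 3) ≤ t3 := by
      have := hE2; rw [div_mul_eq_mul_div, one_mul, le_div_iff₀ (by positivity)] at this; linarith
    have h2 : (A₄ * L ^ 2 + L ^ 2) * (3 * L) = L ^ 3 * (3 * A₄ + 3) := by ring
    linarith only [h1, h2]
  have hubcφ : 40 * L / cφ ≤ ub := by
    refine le_trans ?_ hublo
    rw [div_le_div_iff₀ hcφ (by positivity)]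
    have h1 : L ^ 2 * 680 ≤ cφ * t3 := by
      have := hE5; rw [div_mul_eq_mul_div, le_div_iff₀ (by norm_num)] at this; linarith
    have h2 : 40 * L * (3 * L) = 120 * L ^ 2 := by ring
    have h3 : 0 ≤ L ^ 2 := sq_nonneg L
    rw [h2]; linarith only [h1, h3]
  have hubyL : ub ≤ y / L := by
    rw [hub, hrul, div_le_div_iff₀ (by positivity) hL0]
    have : (y : ℝ) * (1 + u * L / y) = y + u * L := by field_simp
    rw [this]; nlinarith only [hy0, hu0, hL0]
  have huby : ub ≤ y := hubyL.trans (div_le_self hy0.le hL1)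
  -- `Q = 1/ū`
  set Q : ℝ := 1 / ub with hQ
  have hQ0 : 0 ≤ Q := by positivity
  have hQpos : 0 < Q := by positivity
  have hQ1 : Q ≤ 1 := by rw [hQ, div_le_one hub0]; exact hub1
  have hQy : 1 / (y : ℝ) ≤ Q := one_div_le_one_div_of_le hub0 huby
  have hQL : Q ≤ cφ / (40 * L) := by
    rw [hQ, one_div_le hub0 (by positivity), one_div_div]; exact hubcφ
  -- ### the saddle point
  set α : ℝ := saddlePoint x y with hαdef
  have hα0 : 0 < α := saddlePoint_pos hx1 hy2
  have hl4 := log_four_le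
  have hα1 : α ≤ 1 := saddlePoint_le_one_of_lt_log hx1 hy2 (by rw [← hL]; linarith only [hE7, ht3logx, hL100, hl4])
  have hαlow : 1 / (12 * L * r) ≤ α := by
    have h := hαmin x y hyα hyx
    refine le_trans ?_ h
    rw [← hL, mul_min_of_nonneg _ _ (by norm_num : (0 : ℝ) ≤ 1 / 12)]
    refine le_min ?_ ?_
    · rw [show 1 / 12 * (1 / L) = 1 / (12 * L) by ring]
      exact one_div_le_one_div_of_le (by positivity) (le_mul_of_one_le_right (by positivity) hr1)
    · rw [hr, show 1 / 12 * (y / (L * Real.log x)) = 1 / (12 * L * (Real.log x / y)) by field_simp]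
      refine one_div_le_one_div_of_le (by positivity) ?_
      have : Real.log x / y ≤ 1 + Real.log x / y := by linarith only [show (0:ℝ) ≤ 1 from zero_le_one]
      exact mul_le_mul_of_nonneg_left this (by positivity)
  have hαinv : 1 / α ≤ 12 * L * r := by
    rw [one_div_le hα0 (by positivity)]; exact hαlow
  -- `α log x ≤ π(y) ≤ 6y/log y`, so `α u ≤ 6 y/L²`
  set k : ℝ := (#(Nat.primesLE y) : ℝ) with hk
  have hk6 : k ≤ 6 * (y / L) := card_primesLE_le_six_mul_div_log hy2
  have hklo' : (y : ℝ) / (4 * L) ≤ k := hklo y hyk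
  have hk0 : 0 < k := lt_of_lt_of_le (by positivity) hklo'
  have hαlogx : α * Real.log x ≤ k := by
    have h := saddleSum_le_card_div' hα0 y
    rw [saddleSum_saddlePoint hx1 hy2] at h
    rwa [le_div_iff₀ hα0, mul_comm] at h
  have hαuL : α * u * L ≤ k := by rw [mul_assoc, huL]; exact hαlogx
  have hαu : α * u ≤ 6 * y / L ^ 2 := by
    rw [le_div_iff₀ (by positivity)]
    have h1 : α * u * L ^ 2 = (α * u * L) * L := by ring
    rw [h1]
    have h2 : (α * u * L) * L ≤ k * L := mul_le_mul_of_nonneg_right hαuL hL0.le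
    have h3 : k * L ≤ 6 * (y / L) * L := mul_le_mul_of_nonneg_right hk6 hL0.le
    have h4 : 6 * (y / L) * L = 6 * y := by field_simp
    linarith
  -- ### `φ`, `Φ₃`, `Φ₄`
  set φ : ℝ := saddlePhi₂ α y with hφdef
  have hφ0 : 0 < φ := saddlePhi₂_pos hy2 hα0
  have hLlogx : Real.log x * Real.log y + Real.log x ^ 2 * Real.log y / y = L ^ 2 * u * r := by
    rw [hrul, ← huL, ← hL]; field_simp
  obtain ⟨hφlo, hφhi⟩ := hφ2 x y hyφ hyx
  rw [hLlogx] at hφlo hφhi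
  change cφ * (L ^ 2 * u * r) ≤ φ at hφlo
  change φ ≤ Cφ * (L ^ 2 * u * r) at hφhi
  set Φ₃ : ℝ := saddlePhi₃ α y with hΦ₃def
  set Φ₄ : ℝ := saddlePhi₄ α y with hΦ₄def
  have hΦ₃0 : 0 ≤ Φ₃ := saddlePhi₃_nonneg hα0 y
  have hΦ₄0 : 0 ≤ Φ₄ := saddlePhi₄_nonneg hα0 y
  have huLy0 : 0 ≤ u * L / y := by positivity
  have hΦ₃ : Φ₃ ≤ C₃ * (L ^ 3 * u * r ^ 2) := by
    have h := hΦ₃u x y hy₃ hyx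
    refine h.trans ?_
    rw [← hL]
    have e1 : Real.log x * L ^ 2 + Real.log x ^ 3 * L ^ 2 / y ^ 2 = L ^ 3 * u * (1 + (u * L / y) ^ 2) := by
      rw [← huL]; field_simp
    rw [e1, hrul]
    refine mul_le_mul_of_nonneg_left (mul_le_mul_of_nonneg_left ?_ (by positivity)) hC₃.le
    exact one_add_sq_le_sq huLy0
  have hΦ₄ : Φ₄ ≤ C₄ * (L ^ 4 * u * r ^ 3) := by
    have h := hΦ₄u x y hy₄ hyx
    refine h.trans ?_
    rw [← hL]
    have e1 : Real.log x * L ^ 3 + Real.log x ^ 4 * L ^ 3 / y ^ 3 = L ^ 4 * u * (1 + (u * L / y) ^ 3) := by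
      rw [← huL]; field_simp
    rw [e1, hrul]
    refine mul_le_mul_of_nonneg_left (mul_le_mul_of_nonneg_left ?_ (by positivity)) hC₄.le
    exact one_add_cube_le_cube huLy0
  -- the basic ratios
  have hLur0 : 0 < L ^ 2 * u * r := by positivity
  have hL2r2 : 1 ≤ L ^ 2 * r ^ 2 := one_le_mul_of_one_le_of_one_le (one_le_pow₀ hL1) (one_le_pow₀ hr1)
  have hφinv : 1 / φ ≤ 1 / cφ * Q := by
    have h1 : 1 / φ ≤ 1 / (cφ * (L ^ 2 * u * r)) := one_div_le_one_div_of_le (by positivity) hφlo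
    have h2 : 1 / (cφ * (L ^ 2 * u * r)) ≤ 1 / cφ * Q := by
      rw [hQ, hub, one_div_div, div_le_iff₀ (by positivity)]
      have : 1 / cφ * (r / u) * (cφ * (L ^ 2 * u * r)) = L ^ 2 * r ^ 2 := by field_simp
      rw [this]; exact hL2r2
    exact h1.trans h2
  have hφsq : (cφ * (L ^ 2 * u * r)) ^ 2 ≤ φ ^ 2 := pow_le_pow_left₀ (by positivity) hφlo 2
  have hφcu : (cφ * (L ^ 2 * u * r)) ^ 3 ≤ φ ^ 3 := pow_le_pow_left₀ (by positivity) hφlo 3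
  have hR4 : Φ₄ / φ ^ 2 ≤ C₄ / cφ ^ 2 * Q := by
    rw [div_le_iff₀ (by positivity), hQ, hub]
    have h1 : C₄ / cφ ^ 2 * (1 / (u / r)) * (cφ * (L ^ 2 * u * r)) ^ 2 ≤ C₄ / cφ ^ 2 * (1 / (u / r)) * φ ^ 2 :=
      mul_le_mul_of_nonneg_left hφsq (by positivity)
    have h2 : C₄ / cφ ^ 2 * (1 / (u / r)) * (cφ * (L ^ 2 * u * r)) ^ 2 = C₄ * (L ^ 4 * u * r ^ 3) := by
      field_simp
    linarith
  have hR3' : Φ₃ / φ ^ 2 ≤ C₃ / cφ ^ 2 * (1 / (L * u)) := by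
    rw [div_le_iff₀ (by positivity)]
    have h1 : C₃ / cφ ^ 2 * (1 / (L * u)) * (cφ * (L ^ 2 * u * r)) ^ 2 ≤ C₃ / cφ ^ 2 * (1 / (L * u)) * φ ^ 2 :=
      mul_le_mul_of_nonneg_left hφsq (by positivity)
    have h2 : C₃ / cφ ^ 2 * (1 / (L * u)) * (cφ * (L ^ 2 * u * r)) ^ 2 = C₃ * (L ^ 3 * u * r ^ 2) := by
      field_simp
    linarith
  have hR3 : Φ₃ / (α * φ ^ 2) ≤ 12 * (C₃ / cφ ^ 2) * Q := by
    rw [show Φ₃ / (α * φ ^ 2) = (1 / α) * (Φ₃ / φ ^ 2) by field_simp]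
    have h1 : (1 / α) * (Φ₃ / φ ^ 2) ≤ (12 * L * r) * (C₃ / cφ ^ 2 * (1 / (L * u))) :=
      mul_le_mul hαinv hR3' (by positivity) (by positivity)
    have h2 : (12 * L * r) * (C₃ / cφ ^ 2 * (1 / (L * u))) = 12 * (C₃ / cφ ^ 2) * Q := by
      rw [hQ, hub]; field_simp
    linarith
  have hR33 : Φ₃ ^ 2 / φ ^ 3 ≤ C₃ ^ 2 / cφ ^ 3 * Q := by
    rw [div_le_iff₀ (by positivity), hQ, hub]
    have h1 : C₃ ^ 2 / cφ ^ 3 * (1 / (u / r)) * (cφ * (L ^ 2 * u * r)) ^ 3 ≤ C₃ ^ 2 / cφ ^ 3 * (1 / (u / r)) * φ ^ 3 :=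
      mul_le_mul_of_nonneg_left hφcu (by positivity)
    have h2 : C₃ ^ 2 / cφ ^ 3 * (1 / (u / r)) * (cφ * (L ^ 2 * u * r)) ^ 3 = (C₃ * (L ^ 3 * u * r ^ 2)) ^ 2 := by
      field_simp
    have h3 : Φ₃ ^ 2 ≤ (C₃ * (L ^ 3 * u * r ^ 2)) ^ 2 := pow_le_pow_left₀ hΦ₃0 hΦ₃ 2
    linarith
  -- `G = α√φ`
  set sφ : ℝ := Real.sqrt φ with hsφ
  have hsφ0 : 0 < sφ := Real.sqrt_pos.2 hφ0
  have hsφsq : sφ ^ 2 = φ := Real.sq_sqrt hφ0.le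
  set G : ℝ := α * sφ with hG
  have hG0 : 0 < G := by positivity
  have hGsq : G ^ 2 = α ^ 2 * φ := by rw [hG, mul_pow, hsφsq]
  have hGlo : cφ / 144 * ub ≤ α ^ 2 * φ := by
    rw [hub]
    have h1 : (1 / (12 * L * r)) ^ 2 ≤ α ^ 2 := pow_le_pow_left₀ (by positivity) hαlow 2
    have h2 : (1 / (12 * L * r)) ^ 2 * (cφ * (L ^ 2 * u * r)) = cφ / 144 * (u / r) := by field_simp; ring
    calc cφ / 144 * (u / r) = (1 / (12 * L * r)) ^ 2 * (cφ * (L ^ 2 * u * r)) := h2.symm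
      _ ≤ α ^ 2 * (cφ * (L ^ 2 * u * r)) := mul_le_mul_of_nonneg_right h1 (by positivity)
      _ ≤ α ^ 2 * φ := mul_le_mul_of_nonneg_left hφlo (by positivity)
  have hGinv : 1 / (α ^ 2 * φ) ≤ 144 / cφ * Q := by
    rw [hQ, show 144 / cφ * (1 / ub) = 1 / (cφ / 144 * ub) by field_simp]
    exact one_div_le_one_div_of_le (by positivity) hGlo
  have hGhi : G ^ 2 ≤ Cg * L * y := by
    rw [hGsq]
    rcases le_or_gt (α * L) 1 with hαL | hαL
    · have h1 : φ ≤ 3 * k / α ^ 2 := saddlePhi₂_le_card_div hα0 hαL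
      have h2 : α ^ 2 * φ ≤ 3 * k := by
        have := mul_le_mul_of_nonneg_left h1 (sq_nonneg α)
        rwa [mul_div_cancel₀ _ (by positivity)] at this
      have h3 : y / L ≤ L * y := by
        rw [div_le_iff₀ hL0]
        have hLL : 1 ≤ L * L := by nlinarith only [hL1]
        nlinarith only [mul_le_mul_of_nonneg_left hLL hy0.le]
      have h5 : 18 * (L * y) ≤ Cg * L * y := by
        rw [hCg]
        have : 0 ≤ 42 * Cφ * (L * y) := by positivity
        nlinarith only [this]
      linarith only [h2, hk6, h3, h5]
    · have huk : u ≤ k := by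
        have h1 := mul_lt_mul_of_pos_left hαL hu0
        nlinarith only [h1, hαuL]
      have huy : u * L ≤ 6 * y := by
        have := mul_le_mul_of_nonneg_right (huk.trans hk6) hL0.le
        rwa [show 6 * (y / L) * L = 6 * y by field_simp] at this
      have hr7 : r ≤ 7 := by
        rw [hrul]
        have : u * L / y ≤ 6 := by rw [div_le_iff₀ hy0]; linarith
        linarith
      have h1 : α ^ 2 * φ ≤ φ := by
        have : α ^ 2 ≤ 1 := pow_le_one₀ hα0.le hα1
        have := mul_le_mul_of_nonneg_right this hφ0.le
        linarith only [this]
      have h3 : L ^ 2 * u * r ≤ L * (6 * y) * 7 := by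
        rw [show L ^ 2 * u * r = L * (u * L) * r by ring]
        exact mul_le_mul (mul_le_mul_of_nonneg_left huy hL0.le) hr7 hr0.le (by positivity)
      have h4 : φ ≤ Cφ * (L * (6 * y) * 7) := hφhi.trans (mul_le_mul_of_nonneg_left h3 hCφ.le)
      have h5 : Cφ * (L * (6 * y) * 7) ≤ Cg * L * y := by
        rw [hCg]; nlinarith only [mul_pos hL0 hy0, hCφ]
      linarith only [h1, h4, h5]
  have hGy2 : G ≤ (y : ℝ) ^ 2 := by
    have h1 : G ^ 2 ≤ ((y : ℝ) ^ 2) ^ 2 := by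
      refine hGhi.trans ?_
      have : Cg * L ≤ (y : ℝ) ^ 3 := by
        have := hE8; rw [div_mul_eq_mul_div, one_mul, le_div_iff₀ hCg0] at this; linarith
      have h2 := mul_le_mul_of_nonneg_right this hy0.le
      have h3 : (y : ℝ) ^ 3 * y = ((y : ℝ) ^ 2) ^ 2 := by ring
      linarith only [h2, h3]
    exact (abs_le_of_sq_le_sq' h1 (by positivity)).2
  have hGy2' : α * Real.sqrt φ ≤ (y : ℝ) ^ 2 := hGy2
  -- ### the parameters
  set W : ℝ := Real.sqrt (40 * L) with hW
  have hW0 : 0 < W := Real.sqrt_pos.2 (by positivity)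
  have hWsq : W ^ 2 = 40 * L := Real.sq_sqrt (by positivity)
  set τ : ℝ := W / sφ with hτ
  have hτ0 : 0 < τ := by positivity
  have hτsq : τ ^ 2 = 40 * L / φ := by rw [hτ, div_pow, hWsq, hsφsq]
  set Tg : ℝ := max 4 (α * ub / 1000) with hTg
  have hTg4 : 4 ≤ Tg := le_max_left _ _
  have hTg0 : 0 < Tg := by linarith
  have hTgα : α * ub / 1000 ≤ Tg := le_max_right _ _
  have hαub : α * ub ≤ 6 * y / L ^ 2 := le_trans (mul_le_mul_of_nonneg_left hubu hα0.le) hαu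
  have hTghi : Tg ≤ 4 + 6 * y / L ^ 2 / 1000 := by
    rw [hTg]
    refine max_le ?_ (by linarith)
    have : 0 ≤ 6 * y / L ^ 2 / 1000 := by positivity
    linarith
  set Td : ℝ := Tg * L / 2 with hTd
  have hTd0 : 0 < Td := by positivity
  have hTd3 : 3 ≤ Td := by
    rw [hTd, le_div_iff₀ (by norm_num)]; nlinarith only [hTg4, hL100]
  have h300 : 300 * L ^ 2 ≤ y := by
    have := hE6; rw [div_mul_eq_mul_div, one_mul, le_div_iff₀ (by norm_num)] at this; linarith
  have hTdy : Td ≤ y / (100 * L) := by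
    rw [hTd, div_le_div_iff₀ (by norm_num) (by positivity)]
    have h1 : Tg * L * (100 * L) ≤ (4 + 6 * y / L ^ 2 / 1000) * L * (100 * L) :=
      mul_le_mul_of_nonneg_right (mul_le_mul_of_nonneg_right hTghi hL0.le) (by positivity)
    have h2 : (4 + 6 * y / L ^ 2 / 1000) * L * (100 * L) = 400 * L ^ 2 + 6 / 10 * y := by field_simp; ring
    linarith only [h1, h2, h300]
  have hTdy' : Td ≤ y := hTdy.trans (div_le_self hy0.le (by linarith only [hL100]))
  -- `ε`
  set ε : ℝ := Real.exp (-(cd * ((y : ℝ) ^ (1 - α) / Real.log y ^ 5))) with hε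
  have hε0 : 0 ≤ ε := (Real.exp_pos _).le
  have hε9 : ε ≤ Real.exp (-(9 * L)) := by
    rw [hε]; refine Real.exp_le_exp.2 (neg_le_neg ?_)
    rw [← hL]
    have hmin := min_sqrt_le_rpow_one_sub_saddlePoint hx1 hy3 hα1
    rw [← hαdef, ← hL, ht2sq] at hmin
    have hlow : 9 * L ^ 6 / cd ≤ (y : ℝ) ^ (1 - α) := by
      refine le_trans (le_min ?_ ?_) hmin
      · rw [div_le_iff₀ hcd]; linarith [hE4]
      · rw [div_le_div_iff₀ hcd (by positivity), ← huL]
        have h1 : L ^ 7 * 162 ≤ cd * t3 := by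
          have := hE3; rw [div_mul_eq_mul_div, le_div_iff₀ (by norm_num)] at this; linarith
        have h2 := mul_le_mul_of_nonneg_left hut3 hcd.le
        have e : 9 * L ^ 6 * (9 * L) = 81 * L ^ 7 := by ring
        rw [e]; linarith only [h1, h2]
    have := mul_le_mul_of_nonneg_left hlow hcd.le
    rw [mul_div_cancel₀ _ hcd.ne'] at this
    calc 9 * L = 9 * L ^ 6 / L ^ 5 := by field_simp
      _ ≤ cd * (y : ℝ) ^ (1 - α) / L ^ 5 := div_le_div_of_nonneg_right this (by positivity)
      _ = cd * ((y : ℝ) ^ (1 - α) / L ^ 5) := by ring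
  have hεy : ε ≤ ((y : ℝ) ^ 9)⁻¹ := by
    refine hε9.trans (le_of_eq ?_)
    have h := exp_neg_natMul_log hy0 9; rw [hL]; exact_mod_cast h
  have hdec : ∀ t : ℝ, Real.pi / Real.log y ≤ |t| → |t| ≤ Td →
      ‖smoothZetaC ((α : ℂ) + t * I) y‖ ≤ smoothZeta α y * ε := fun t ht1 ht2 =>
    hdecP y hyd α hα0 hα1 t ht1 (ht2.trans (by rw [← hL]; exact hTdy))
  -- near-axis parameters
  have hφ340 : 340 * Real.log y ^ 3 ≤ φ := by
    rw [← hL]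
    refine le_trans ?_ hφlo
    have h2 : L ^ 2 * 680 ≤ cφ * t3 := by
      have := hE5; rw [div_mul_eq_mul_div, le_div_iff₀ (by norm_num)] at this; linarith
    have h1 : 340 * L ^ 3 ≤ cφ * (L ^ 2 * u * 1) := by
      have k1 : L ^ 2 * 680 ≤ cφ * (2 * L * u) := h2.trans (mul_le_mul_of_nonneg_left hut3 hcφ.le)
      nlinarith only [k1, hL0]
    have h3 : cφ * (L ^ 2 * u * 1) ≤ cφ * (L ^ 2 * u * r) :=
      mul_le_mul_of_nonneg_left (mul_le_mul_of_nonneg_left hr1 (by positivity)) hcφ.le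
    linarith
  obtain ⟨a, K, ha, hK17, haK, hnear⟩ := hnearP x y hyN hyx hφ340
  rw [← hL] at hK17
  have hK64 : 64 ≤ K := by linarith
  have hK4 : 4 ≤ K := by linarith
  -- ### the window smallness `Φ₃τ³/6 + Φ₄τ⁴ ≤ 1`
  have hQA₄ : Q * (A₄ * L ^ 2) ≤ 1 := by
    rw [hQ, one_div_mul_eq_div, div_le_one hub0]; linarith only [hubA₄, sq_nonneg L]
  have hQA₃ : Q * (A₃ * L ^ 3) ≤ 1 := by
    rw [hQ, one_div_mul_eq_div, div_le_one hub0]; linarith only [hubA₃, (pow_pos hL0 3).le]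
  have hτ4 : Φ₄ * τ ^ 4 ≤ 1 / 2 := by
    rw [show τ ^ 4 = (τ ^ 2) ^ 2 by ring, hτsq, div_pow,
      show Φ₄ * ((40 * L) ^ 2 / φ ^ 2) = 1600 * L ^ 2 * (Φ₄ / φ ^ 2) by ring]
    have h2 : 1600 * L ^ 2 * (Φ₄ / φ ^ 2) ≤ 1600 * L ^ 2 * (C₄ / cφ ^ 2 * Q) :=
      mul_le_mul_of_nonneg_left hR4 (by positivity)
    have h3 : 1600 * L ^ 2 * (C₄ / cφ ^ 2 * Q) = 1 / 2 * (Q * (A₄ * L ^ 2)) := by rw [hA₄]; ring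
    linarith only [h2, h3, hQA₄]
  have hτ3 : Φ₃ / 6 * τ ^ 3 ≤ 1 / 2 := by
    have hsq : (Φ₃ * τ ^ 3) ^ 2 ≤ 9 := by
      rw [show (Φ₃ * τ ^ 3) ^ 2 = Φ₃ ^ 2 * (τ ^ 2) ^ 3 by ring, hτsq, div_pow,
        show Φ₃ ^ 2 * ((40 * L) ^ 3 / φ ^ 3) = 64000 * L ^ 3 * (Φ₃ ^ 2 / φ ^ 3) by ring]
      have h2 : 64000 * L ^ 3 * (Φ₃ ^ 2 / φ ^ 3) ≤ 64000 * L ^ 3 * (C₃ ^ 2 / cφ ^ 3 * Q) :=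
        mul_le_mul_of_nonneg_left hR33 (by positivity)
      have h3 : 64000 * L ^ 3 * (C₃ ^ 2 / cφ ^ 3 * Q) = 64000 / 7112 * (Q * (A₃ * L ^ 3)) := by rw [hA₃]; ring
      linarith only [h2, h3, hQA₃]
    have h0 : 0 ≤ Φ₃ * τ ^ 3 := by positivity
    nlinarith only [hsq, h0]
  have hsmall : Φ₃ / 6 * τ ^ 3 + Φ₄ * τ ^ 4 ≤ 1 := by linarith only [hτ3, hτ4]
  -- ### apply the core
  have hy1' : Real.pi / Real.log y ≤ 1 := by
    rw [div_le_one (by rw [← hL]; exact hL0), ← hL]; linarith only [Real.pi_lt_d2, hL100]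
  have hcore := GaussSaddle.abs_rpow_mul_card_sub_main_le_tau (x := x) (y := y) (Tg := Tg) (W := W) (Td := Td)
    (ε := ε) (a := a) (K := K) hx1 hy2 hα1 hTg4 hW0 hy1' hTd3 hε0 ha hK4 hnear hdec hsmall le_rfl le_rfl
  rw [← hαdef] at hcore
  rw [← hφdef, ← hΦ₃def, ← hΦ₄def] at hcore
  rw [← hsφ] at hcore
  rw [← hτ] at hcore
  -- ### the relative bounds
  have hπ := Real.pi_pos
  have hQτ : L * r * τ ≤ 1 := by
    have hsq : (L * r * τ) ^ 2 ≤ 1 := by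
      rw [mul_pow, hτsq]
      -- `(Lr)² · 40L/φ ≤ 40 L³ r²/(cφ L² u r) = (40 L/cφ) Q ≤ 1`
      have h1 : (L * r) ^ 2 * (40 * L / φ) ≤ (L * r) ^ 2 * (40 * L / (cφ * (L ^ 2 * u * r))) := by
        refine mul_le_mul_of_nonneg_left ?_ (by positivity)
        exact div_le_div_of_nonneg_left (by positivity) (by positivity) hφlo
      have h2 : (L * r) ^ 2 * (40 * L / (cφ * (L ^ 2 * u * r))) = 40 * L / cφ * Q := by
        rw [hQ, hub]; field_simp
      have h3 : 40 * L / cφ * Q ≤ 1 := by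
        have := mul_le_mul_of_nonneg_left hQL (by positivity : (0 : ℝ) ≤ 40 * L / cφ)
        rwa [show 40 * L / cφ * (cφ / (40 * L)) = 1 by field_simp] at this
      linarith only [h1, h2, h3]
    have h0 : 0 ≤ L * r * τ := by positivity
    nlinarith only [hsq, h0]
  have hR4τ : Φ₄ * τ / (α * φ ^ 2) ≤ 12 * (C₄ / cφ ^ 2) * Q := by
    rw [show Φ₄ * τ / (α * φ ^ 2) = (1 / α * τ) * (Φ₄ / φ ^ 2) by field_simp]
    have h1 : 1 / α * τ ≤ 12 := by
      calc 1 / α * τ ≤ 12 * L * r * τ := mul_le_mul_of_nonneg_right hαinv hτ0.le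
        _ = 12 * (L * r * τ) := by ring
        _ ≤ 12 * 1 := by linarith only [hQτ]
        _ = 12 := by norm_num
    have h2 : 0 ≤ 1 / α * τ := by positivity
    calc 1 / α * τ * (Φ₄ / φ ^ 2) ≤ 12 * (C₄ / cφ ^ 2 * Q) := mul_le_mul h1 hR4 (by positivity) (by norm_num)
      _ = 12 * (C₄ / cφ ^ 2) * Q := by ring
  have hexpQ : Real.exp (-(10 * L)) ≤ Q := by
    refine le_trans ?_ hQy
    have h := exp_neg_natMul_log hy0 10
    have h' : Real.exp (-(10 * L)) = ((y : ℝ) ^ 10)⁻¹ := by rw [hL]; exact_mod_cast h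
    rw [h', inv_eq_one_div]
    exact one_div_le_one_div_of_le hy0 (le_self_pow₀ hy1.le (by norm_num))
  have hTgQ : α / Tg ≤ 1000 * Q := by
    have h1 : α / Tg ≤ α / (α * ub / 1000) := div_le_div_of_nonneg_left hα0.le (by positivity) hTgα
    rw [show α / (α * ub / 1000) = 1000 * Q by rw [hQ]; field_simp] at h1
    exact h1
  have hwin := window_rel_le (Φ₃ := Φ₃) (Φ₄ := Φ₄) hα0 hφ0 hΦ₃0 hΦ₄0 hτ0.le hτsq hTg4 hQ0 hQ1
    (by positivity : (0 : ℝ) ≤ 12 * (C₃ / cφ ^ 2)) (by positivity : (0 : ℝ) ≤ 1 / cφ)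
    (by positivity : (0 : ℝ) ≤ 144 / cφ)
    hR4 hR3 hR33 hφinv hGinv hR4τ hexpQ
  have htail := tail_rel_le (y := y) hα0 hφ0 hτsq hTg4 hTd ha hK64 hK17 haK hL hL100 hy1 hε0 hεy hTdy'
    hGy2' hQy
  have hmean := mean_rel_le (y := y) hα0 hφ0 hTg4 hTd ha hK64 haK hL hL100 hy1 hε0 hεy hGy2' hTgQ hQy
  rw [← hsφ] at hwin htail hmean
  rw [← hφdef] at haK
  -- ### combine
  set ζ₀ : ℝ := smoothZeta α y with hζ₀
  have hζ0 : 0 < ζ₀ := smoothZeta_pos hα0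
  set Kw : ℝ := ‖((α : ℝ) : ℂ)⁻¹‖ * (Real.exp (-(φ / 4) * τ ^ 2) * Real.sqrt (4 * Real.pi / φ)) +
        Real.sqrt (4 * Real.pi / φ) *
          (Real.exp 1 * (1 / α ^ 3 + 1 / (2 * Tg ^ 2 * α)) * (4 * 1 / (Real.exp 1 * φ)) ^ 1 +
            (‖((α : ℝ) : ℂ)⁻¹‖ * Φ₄ + ‖-I / ((α : ℝ) : ℂ) ^ 2‖ * (Φ₃ / 3 + 2 * Φ₄ * τ)) *
              (4 * 2 / (Real.exp 1 * φ)) ^ 2 +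
            (‖((α : ℝ) : ℂ)⁻¹‖ * Φ₃ ^ 2 / 18) * (4 * 3 / (Real.exp 1 * φ)) ^ 3 +
            2 * ‖((α : ℝ) : ℂ)⁻¹‖ * Φ₄ ^ 2 * (4 * 4 / (Real.exp 1 * φ)) ^ 4) with hKwdef
  set Kt : ℝ := (1 + a * τ ^ 2) ^ (-(K / 4)) *
          (Real.sqrt (8 * Real.pi / (a * K)) + 2 * (2 : ℝ) ^ (-(K / 4)) * Real.pi / Real.sqrt a) / α +
        6 * ε * Real.log y + 2 * Real.pi / 3 * ε * Td +
        2 * Real.pi * (4 * Tg ^ 2 * Real.exp (-1) * Real.exp (-(Td ^ 2 / (4 * Tg ^ 2)))) / Td ^ 2 with hKtdef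
  set br : ℝ := Real.sqrt (Real.pi / (a * K / 4)) +
        (2 * (2 : ℝ) ^ (-(K / 2)) / a) * Real.pi / (1 / Real.sqrt a) + ε * (2 * Td) +
        Real.exp (-(Td ^ 2 / Tg ^ 2)) * Real.sqrt (Real.pi / (1 / Tg ^ 2)) with hbrdef
  set m : ℝ := ζ₀ / (α * Real.sqrt (2 * Real.pi * φ)) with hm
  have hsqrt2πφ : Real.sqrt (2 * Real.pi * φ) = Real.sqrt (2 * Real.pi) * sφ := Real.sqrt_mul (by positivity) φ
  have hs2π0 : 0 < Real.sqrt (2 * Real.pi) := Real.sqrt_pos.2 (by positivity)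
  have hs2πsq : Real.sqrt (2 * Real.pi) * Real.sqrt (2 * Real.pi) = 2 * Real.pi := Real.mul_self_sqrt (by positivity)
  have hs2π3 : Real.sqrt (2 * Real.pi) ≤ 3 := by
    rw [Real.sqrt_le_left (by norm_num)]; linarith only [Real.pi_lt_d2]
  have hm0 : 0 < m := by positivity
  have hζm : ζ₀ = Real.sqrt (2 * Real.pi) * (α * sφ) * m := by
    rw [hm, hsqrt2πφ]; field_simp
  set cw' : ℝ := 4 + 16 * (144 / cφ + 1 / cφ) + 32 * (C₄ / cφ ^ 2 + 12 * (C₃ / cφ ^ 2) + 2 * (12 * (C₄ / cφ ^ 2))) +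
    20 * (C₃ ^ 2 / cφ ^ 3) + 8800 * (C₄ / cφ ^ 2) ^ 2 with hcw'
  have hcw'cw : cw' = cw := by rw [hcw', hcw]
  have hsum : (α * sφ) * (Kw + Kt) ≤ (cw + 70) * Q := by rw [← hcw'cw]; linarith only [hwin, htail]
  have hΔ : ζ₀ / (2 * Real.pi) * (Kw + Kt) ≤ (cw + 70) * Q * m := by
    have h1 : ζ₀ / (2 * Real.pi) * (Kw + Kt) = Real.sqrt (2 * Real.pi) / (2 * Real.pi) * m * ((α * sφ) * (Kw + Kt)) := by
      rw [hζm]; ring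
    rw [h1]
    have h2 : Real.sqrt (2 * Real.pi) / (2 * Real.pi) ≤ 1 := by
      rw [div_le_one (by positivity)]; linarith only [Real.pi_gt_three, hs2π3]
    have h3 : 0 ≤ (cw + 70) * Q := by positivity
    have h4 : Real.sqrt (2 * Real.pi) / (2 * Real.pi) * m * ((α * sφ) * (Kw + Kt)) ≤
        Real.sqrt (2 * Real.pi) / (2 * Real.pi) * m * ((cw + 70) * Q) :=
      mul_le_mul_of_nonneg_left hsum (by positivity)
    have h5 : Real.sqrt (2 * Real.pi) / (2 * Real.pi) * m * ((cw + 70) * Q) ≤ 1 * m * ((cw + 70) * Q) :=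
      mul_le_mul_of_nonneg_right (mul_le_mul_of_nonneg_right h2 hm0.le) h3
    linarith only [h4, h5]
  have hM : 4 * Real.sqrt (2 * Real.pi) / Tg * (1 / (2 * Real.pi) * (ζ₀ * br)) ≤ 63000 * Q * m := by
    have h1 : 4 * Real.sqrt (2 * Real.pi) / Tg * (1 / (2 * Real.pi) * (ζ₀ * br)) =
        (Real.sqrt (2 * Real.pi) * Real.sqrt (2 * Real.pi) / (2 * Real.pi)) * m * (4 * (α * sφ) / Tg * br) := by
      rw [hζm]; ring
    rw [h1, hs2πsq, div_self (by positivity), one_mul]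
    have := mul_le_mul_of_nonneg_left hmean hm0.le
    linarith only [this]
  have hs : α ^ 2 / (2 * Tg ^ 2) ≤ 500000 * Q := by
    have h1 : α ^ 2 / (2 * Tg ^ 2) ≤ α ^ 2 / (2 * (α * ub / 1000) ^ 2) := by
      refine div_le_div_of_nonneg_left (by positivity) (by positivity) ?_
      have := pow_le_pow_left₀ (by positivity) hTgα 2
      linarith only [this]
    have h2 : α ^ 2 / (2 * (α * ub / 1000) ^ 2) = 500000 * Q * Q := by rw [hQ]; field_simp; ring
    rw [h2] at h1
    have := mul_le_mul_of_nonneg_left hQ1 (by positivity : (0 : ℝ) ≤ 500000 * Q)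
    linarith only [h1, this]
  set P : ℝ := x ^ (-α) * ((Nat.smoothNumbersUpTo ⌊x⌋₊ (y + 1)).card : ℝ) with hP
  have habs : |P - m| ≤ α ^ 2 / (2 * Tg ^ 2) * (m + ζ₀ / (2 * Real.pi) * (Kw + Kt)) +
      ζ₀ / (2 * Real.pi) * (Kw + Kt) + 4 * Real.sqrt (2 * Real.pi) / Tg * (1 / (2 * Real.pi) * (ζ₀ * br)) := hcore
  have hPm : |P - m| ≤ CB * Q * m := by
    have hQm : 0 ≤ Q * m := by positivity
    have hΔ0 : m + ζ₀ / (2 * Real.pi) * (Kw + Kt) ≤ (1 + cw + 70) * m := by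
      have : (cw + 70) * Q * m ≤ (cw + 70) * 1 * m := by
        exact mul_le_mul_of_nonneg_right (mul_le_mul_of_nonneg_left hQ1 (by positivity)) hm0.le
      linarith only [this, hΔ]
    have h1 : α ^ 2 / (2 * Tg ^ 2) * (m + ζ₀ / (2 * Real.pi) * (Kw + Kt)) ≤ 500000 * Q * ((1 + cw + 70) * m) := by
      rcases le_or_gt 0 (m + ζ₀ / (2 * Real.pi) * (Kw + Kt)) with hpos | hneg
      · exact mul_le_mul hs hΔ0 hpos (by positivity)
      · have h2 : α ^ 2 / (2 * Tg ^ 2) * (m + ζ₀ / (2 * Real.pi) * (Kw + Kt)) ≤ 0 :=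
          mul_nonpos_of_nonneg_of_nonpos (by positivity) hneg.le
        have h3 : 0 ≤ 500000 * Q * ((1 + cw + 70) * m) := by positivity
        linarith only [h2, h3]
    have h2 : CB * Q * m = 500000 * Q * ((1 + cw + 70) * m) + (cw + 70) * Q * m + 63000 * Q * m := by
      rw [hCB]; ring
    rw [h2]
    linarith only [habs, h1, hΔ, hM]
  -- ### back to `Ψ(x, y)`
  have hxα : 0 < x ^ α := Real.rpow_pos_of_pos hx0 α
  have hΨ : ((Nat.smoothNumbersUpTo ⌊x⌋₊ (y + 1)).card : ℝ) = x ^ α * P := by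
    rw [hP, ← mul_assoc, ← Real.rpow_add hx0, add_neg_cancel, Real.rpow_zero, one_mul]
  have hmain : x ^ α * ζ₀ / (α * Real.sqrt (2 * Real.pi * φ)) = x ^ α * m := by rw [hm]; ring
  rw [hΨ, hmain, ← mul_sub, abs_mul, abs_of_pos hxα, ← hinvub]
  calc x ^ α * |P - m| ≤ x ^ α * (CB * Q * m) := mul_le_mul_of_nonneg_left hPm hxα.le
    _ = CB * Q * (x ^ α * m) := by ring

end RegimeB

end Literature.NumberTheory.Sieve

end
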